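import Summits.ValiantsHypothesis.ValiantsHypothesis.Theorems.BarrierLeverChowThinRowsStarColumnsPrelims

/-!
# Route BarrierLever — item `ChowHitsThinRowPartitionMinors` (stmt-ValiantsHypothesis-20195):
# the SINGLETON indicator design at ARBITRARY columns — closed forms of all thin rows

Helper file (`--supports stmt-ValiantsHypothesis-20195`; cell valiant-natproofs, rung V4, 𝒟-side of
door (c); prover seat val-np-p8 gen 2).  Closes NO item; imports the companion
`…ChowThinRowsStarColumnsPrelims` (val-np-p8 g2); no route file, no definitions.

For the indicator forms `φ_V = 1 + Σ_a κ_a(V) x_a + Σ_{c ∈ V} y_c` over a Finset `𝒦` of sets of size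
`≤ 1` (the pure factors `1 + y_c` carrying `x`, plus the `x`-only form `φ_∅`) and an ARBITRARY column
`W` all of whose singletons lie in `𝒦`, the partition coefficients of `∏_𝒦 φ` are the values at the
`0/1`-point `𝟙_W` of explicit polynomials of degree `≤ 2`:
* `coeff_empty_prod_card_le_one` — row `∅`: `1` (and `0` if some singleton of `W` is missing);
* `coeff_single_prod_card_le_one` — row `{a}`: `A_a − κ_a(W)` with `A_a = Σ_V κ_a(V)`,
  `κ_a(W) = Σ_{c∈W} κ_a({c})`;
* `coeff_pair_prod_card_le_one` — row `{a,b}`: `(A_a − κ_a(W))(A_b − κ_b(W)) − Σ_V κ_a(V)κ_b(V) + Σ_{c∈W} κ_a({c})κ_b({c})`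
  (the last sum is the HADAMARD term).
These generalise the star-column entries of `…StarColumnsPrelims` (`W ∈ {∅, {c}}`, balanced `A = 0`)
and are the closed forms behind the balanced designs of HOME/val-np-p8/MEMO-pairlayer-g2.md §1c
(affinely independent columns with one extra pure-`y` form: `M[u,j] = F_u(w_j) + Σ_{c∈w_j} β_c F_u(w_j∖c)`;
Hamming-ball columns with doubled pure factors).

WHAT THIS IS NOT: bookkeeping only; nothing on items 20195 / 20172 / 19717 themselves, on crux
stmt-ValiantsHypothesis-14610, or on `VP` versus `VNP`.
-/

set_option linter.dupNamespace false

namespace Summit.ValiantsHypothesis.ValiantsHypothesis.Theorems.BarrierLever.ChowSubcube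

open Finset MvPolynomial
open Summit.ValiantsHypothesis.ValiantsHypothesis.Theorems.BarrierLever.ProductStateSums
  (castAdd_ne_natAdd partitionExpo_apply_castAdd partitionExpo_apply_natAdd)
open Summit.ValiantsHypothesis.ValiantsHypothesis.Theorems.BarrierLever.CorankRepair (partitionExpo_eq_iff)

variable {h : ℕ}

/-- Row `∅` at an arbitrary column `W`, for a family `𝒦` of sets of size `≤ 1`: the `x`-free coefficient
of `∏_𝒦 φ` at `y^W` is `1` if every singleton `{c}`, `c ∈ W`, belongs to `𝒦`, and `0` otherwise. -/
theorem coeff_empty_prod_card_le_one (κ : Fin h → Finset (Fin h) → ℂ) (𝒦 : Finset (Finset (Fin h)))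
    (h1 : ∀ V ∈ 𝒦, V.card ≤ 1) (W : Finset (Fin h)) :
    coeff (∑ a ∈ (∅ : Finset (Fin h)), Finsupp.single (Fin.castAdd h a) 1 +
        ∑ c ∈ W, Finsupp.single (Fin.natAdd h c) 1)
        (∏ V ∈ 𝒦, (C 1 + ∑ a, C (κ a V) * X (Fin.castAdd h a) +
          ∑ c, C (if c ∈ V then (1 : ℂ) else 0) * X (Fin.natAdd h c))) =
      if ∀ c ∈ W, ({c} : Finset (Fin h)) ∈ 𝒦 then 1 else 0 := by
  classical
  induction 𝒦 using Finset.induction_on generalizing W with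
  | empty =>
    rw [Finset.prod_empty, coeff_one]
    by_cases hW : W = ∅
    · subst hW
      simp
    · obtain ⟨c, hc⟩ := Finset.nonempty_iff_ne_empty.mpr hW
      rw [if_neg, if_neg (fun hall => absurd (hall c hc) (Finset.notMem_empty _))]
      intro e
      have e' := (partitionExpo_eq_iff ∅ ∅ ∅ W).mp (by simpa using e)
      exact hW e'.2.symm
  | insert V 𝒦 hV ih =>
    have h1' : ∀ V' ∈ 𝒦, V'.card ≤ 1 := fun V' hV' => h1 V' (Finset.mem_insert_of_mem hV')
    rw [Finset.prod_insert hV, mul_comm, coeff_empty_mul_form, ih h1' W]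
    -- the filter `{c ∈ W : c ∈ V}`: empty unless `V = {c₀}` with `c₀ ∈ W`
    by_cases hVW : ∃ c₀ ∈ W, V = {c₀}
    · obtain ⟨c₀, hc₀W, rfl⟩ := hVW
      have hfil : (W.filter fun c => c ∈ ({c₀} : Finset (Fin h))) = {c₀} := by
        ext c
        simp only [Finset.mem_filter, Finset.mem_singleton]
        exact ⟨fun hh => hh.2, fun e => ⟨e ▸ hc₀W, e⟩⟩
      rw [hfil, Finset.sum_singleton, ih h1' (W.erase c₀)]
      -- `{c₀} ∉ 𝒦`, so the old indicator at `W` vanishes; the new one equals the old one at `W.erase c₀`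
      have hold : ¬ ∀ c ∈ W, ({c} : Finset (Fin h)) ∈ 𝒦 := fun hall => hV (hall c₀ hc₀W)
      rw [if_neg hold, zero_add]
      by_cases hnew : ∀ c ∈ W, ({c} : Finset (Fin h)) ∈ insert {c₀} 𝒦
      · rw [if_pos hnew, if_pos]
        intro c hc
        rcases Finset.mem_insert.mp (hnew c (Finset.mem_of_mem_erase hc)) with e | e
        · exact absurd (Finset.singleton_injective e) (Finset.ne_of_mem_erase hc)
        · exact e
      · rw [if_neg hnew, if_neg]
        intro hall
        apply hnew
        intro c hc
        by_cases hcc : c = c₀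
        · subst hcc; exact Finset.mem_insert_self _ _
        · exact Finset.mem_insert_of_mem (hall c (Finset.mem_erase.mpr ⟨hcc, hc⟩))
    · -- no element of `W` lies in `V`
      have hfil : (W.filter fun c => c ∈ V) = ∅ := by
        refine Finset.filter_eq_empty_iff.mpr fun c hcW hcV => hVW ⟨c, hcW, ?_⟩
        exact (Finset.eq_singleton_iff_unique_mem.mpr
          ⟨hcV, fun x hx => Finset.card_le_one.mp (h1 V (Finset.mem_insert_self _ _)) x hx c hcV⟩)
      rw [hfil, Finset.sum_empty, add_zero]
      by_cases hold : ∀ c ∈ W, ({c} : Finset (Fin h)) ∈ 𝒦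
      · rw [if_pos hold, if_pos fun c hc => Finset.mem_insert_of_mem (hold c hc)]
      · rw [if_neg hold, if_neg]
        intro hall
        apply hold
        intro c hc
        rcases Finset.mem_insert.mp (hall c hc) with e | e
        · exact absurd ⟨c, hc, e.symm⟩ hVW
        · exact e

/-- Row `{a}` at an arbitrary column `W` whose singletons lie in `𝒦` (sets of size `≤ 1`):
`coeff (E {a} W) ∏_𝒦 φ = Σ_V κ_a(V) − Σ_{c ∈ W} κ_a({c})`. -/
theorem coeff_single_prod_card_le_one (κ : Fin h → Finset (Fin h) → ℂ) (𝒦 : Finset (Finset (Fin h)))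
    (h1 : ∀ V ∈ 𝒦, V.card ≤ 1) (a : Fin h) (W : Finset (Fin h))
    (hW : ∀ c ∈ W, ({c} : Finset (Fin h)) ∈ 𝒦) :
    coeff (∑ a' ∈ ({a} : Finset (Fin h)), Finsupp.single (Fin.castAdd h a') 1 +
        ∑ c ∈ W, Finsupp.single (Fin.natAdd h c) 1)
        (∏ V ∈ 𝒦, (C 1 + ∑ a, C (κ a V) * X (Fin.castAdd h a) +
          ∑ c, C (if c ∈ V then (1 : ℂ) else 0) * X (Fin.natAdd h c))) =
      ∑ V ∈ 𝒦, κ a V - ∑ c ∈ W, κ a {c} := by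
  classical
  rw [coeff_single_prod]
  -- the leave-`V`-out indicator: `1` unless `V` is a singleton of `W`
  have hterm : ∀ V ∈ 𝒦, κ a V *
      coeff (∑ a' ∈ (∅ : Finset (Fin h)), Finsupp.single (Fin.castAdd h a') 1 +
          ∑ c ∈ W, Finsupp.single (Fin.natAdd h c) 1)
        (∏ V' ∈ 𝒦.erase V, (C 1 + ∑ a, C (κ a V') * X (Fin.castAdd h a) +
          ∑ c, C (if c ∈ V' then (1 : ℂ) else 0) * X (Fin.natAdd h c))) =
      κ a V - (if V ∈ W.image (fun c => ({c} : Finset (Fin h))) then κ a V else 0) := by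
    intro V hV
    rw [coeff_empty_prod_card_le_one κ (𝒦.erase V) (fun V' hV' => h1 V' (Finset.mem_of_mem_erase hV')) W]
    by_cases hVW : V ∈ W.image (fun c => ({c} : Finset (Fin h)))
    · obtain ⟨c₀, hc₀, rfl⟩ := Finset.mem_image.mp hVW
      rw [if_neg (fun hall => Finset.notMem_erase _ _ (hall c₀ hc₀)), if_pos hVW, mul_zero, sub_self]
    · rw [if_pos, if_neg hVW, mul_one, sub_zero]
      intro c hc
      exact Finset.mem_erase.mpr ⟨fun e => hVW (Finset.mem_image.mpr ⟨c, hc, e⟩), hW c hc⟩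
  rw [Finset.sum_congr rfl hterm, Finset.sum_sub_distrib, ← Finset.sum_filter]
  congr 1
  have hfil : (𝒦.filter fun V => V ∈ W.image (fun c => ({c} : Finset (Fin h)))) =
      W.image (fun c => ({c} : Finset (Fin h))) := by
    ext V
    simp only [Finset.mem_filter, and_iff_right_iff_imp]
    intro hV
    obtain ⟨c, hc, rfl⟩ := Finset.mem_image.mp hV
    exact hW c hc
  rw [hfil, Finset.sum_image fun c _ c' _ e => Finset.singleton_injective e]

/-- Row `{a,b}` (`a ≠ b`) at an arbitrary column `W` whose singletons lie in `𝒦` (sets of size `≤ 1`):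
`coeff (E {a,b} W) ∏_𝒦 φ = (A_a − κ_a(W))(A_b − κ_b(W)) − Σ_V κ_a(V)κ_b(V) + Σ_{c∈W} κ_a({c})κ_b({c})`,
`A = Σ_V κ(V)`, `κ(W) = Σ_{c∈W} κ({c})` — a quadratic polynomial in `𝟙_W` whose linear part carries the
HADAMARD vector `κ_a ∘ κ_b`. -/
theorem coeff_pair_prod_card_le_one (κ : Fin h → Finset (Fin h) → ℂ) (𝒦 : Finset (Finset (Fin h)))
    (h1 : ∀ V ∈ 𝒦, V.card ≤ 1) {a b : Fin h} (hab : a ≠ b) (W : Finset (Fin h))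
    (hW : ∀ c ∈ W, ({c} : Finset (Fin h)) ∈ 𝒦) :
    coeff (∑ a' ∈ ({a, b} : Finset (Fin h)), Finsupp.single (Fin.castAdd h a') 1 +
        ∑ c ∈ W, Finsupp.single (Fin.natAdd h c) 1)
        (∏ V ∈ 𝒦, (C 1 + ∑ a, C (κ a V) * X (Fin.castAdd h a) +
          ∑ c, C (if c ∈ V then (1 : ℂ) else 0) * X (Fin.natAdd h c))) =
      (∑ V ∈ 𝒦, κ a V - ∑ c ∈ W, κ a {c}) * (∑ V ∈ 𝒦, κ b V - ∑ c ∈ W, κ b {c}) -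
        ∑ V ∈ 𝒦, κ a V * κ b V + ∑ c ∈ W, κ a {c} * κ b {c} := by
  classical
  rw [coeff_pair_prod κ 𝒦 hab]
  set I : Finset (Finset (Fin h)) := W.image (fun c => ({c} : Finset (Fin h))) with hI
  have hIsub : I ⊆ 𝒦 := fun V hV => by
    obtain ⟨c, hc, rfl⟩ := Finset.mem_image.mp hV
    exact hW c hc
  have hsumI : ∀ g : Finset (Fin h) → ℂ, ∑ V ∈ I, g V = ∑ c ∈ W, g {c} := fun g => by
    rw [hI, Finset.sum_image fun c _ c' _ e => Finset.singleton_injective e]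
  -- inner first-order coefficient of the leave-`V`-out product
  have hin : ∀ V ∈ 𝒦,
      coeff (∑ a' ∈ ({b} : Finset (Fin h)), Finsupp.single (Fin.castAdd h a') 1 +
          ∑ c ∈ W, Finsupp.single (Fin.natAdd h c) 1)
        (∏ V' ∈ 𝒦.erase V, (C 1 + ∑ a, C (κ a V') * X (Fin.castAdd h a) +
          ∑ c, C (if c ∈ V' then (1 : ℂ) else 0) * X (Fin.natAdd h c))) =
      if V ∈ I then 0 else (∑ V' ∈ 𝒦, κ b V' - κ b V) - ∑ c ∈ W, κ b {c} := by
    intro V hV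
    by_cases hVI : V ∈ I
    · -- `V = {c₀}`, `c₀ ∈ W`: the singleton `{c₀}` is missing from every leave-out family
      rw [if_pos hVI, coeff_single_prod]
      obtain ⟨c₀, hc₀, rfl⟩ := Finset.mem_image.mp hVI
      refine Finset.sum_eq_zero fun V' hV' => ?_
      rw [coeff_empty_prod_card_le_one κ ((𝒦.erase {c₀}).erase V')
        (fun V'' hV'' => h1 V'' (Finset.mem_of_mem_erase (Finset.mem_of_mem_erase hV''))) W,
        if_neg (fun hall => Finset.notMem_erase _ _ (Finset.mem_of_mem_erase (hall c₀ hc₀))), mul_zero]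
    · rw [if_neg hVI, coeff_single_prod_card_le_one κ (𝒦.erase V)
        (fun V' hV' => h1 V' (Finset.mem_of_mem_erase hV')) b W
        (fun c hc => Finset.mem_erase.mpr ⟨fun e => hVI (Finset.mem_image.mpr ⟨c, hc, e⟩), hW c hc⟩),
        Finset.sum_erase_eq_sub hV]
  rw [Finset.sum_congr rfl fun V hV => by rw [hin V hV]]
  -- Σ_V κ_a(V) · (if V ∈ I then 0 else (A_b − κ_b V) − κ_b(W))
  have hsplit : ∀ V ∈ 𝒦, κ a V * (if V ∈ I then 0 else (∑ V' ∈ 𝒦, κ b V' - κ b V) - ∑ c ∈ W, κ b {c}) =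
      κ a V * ((∑ V' ∈ 𝒦, κ b V' - κ b V) - ∑ c ∈ W, κ b {c}) -
        (if V ∈ I then κ a V * ((∑ V' ∈ 𝒦, κ b V' - κ b V) - ∑ c ∈ W, κ b {c}) else 0) := by
    intro V _
    split_ifs <;> ring
  rw [Finset.sum_congr rfl hsplit, Finset.sum_sub_distrib, ← Finset.sum_filter,
    (Finset.filter_mem_eq_inter : _ ) ]
  rw [Finset.inter_eq_right.mpr hIsub, hsumI]
  have e1 : ∑ V ∈ 𝒦, κ a V * ((∑ V' ∈ 𝒦, κ b V' - κ b V) - ∑ c ∈ W, κ b {c}) =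
      (∑ V ∈ 𝒦, κ a V) * (∑ V' ∈ 𝒦, κ b V' - ∑ c ∈ W, κ b {c}) - ∑ V ∈ 𝒦, κ a V * κ b V := by
    rw [Finset.sum_mul, ← Finset.sum_sub_distrib]
    exact Finset.sum_congr rfl fun V _ => by ring
  have e2 : ∑ c ∈ W, κ a {c} * ((∑ V' ∈ 𝒦, κ b V' - κ b {c}) - ∑ c' ∈ W, κ b {c'}) =
      (∑ c ∈ W, κ a {c}) * (∑ V' ∈ 𝒦, κ b V' - ∑ c' ∈ W, κ b {c'}) - ∑ c ∈ W, κ a {c} * κ b {c} := by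
    rw [Finset.sum_mul, ← Finset.sum_sub_distrib]
    exact Finset.sum_congr rfl fun c _ => by ring
  rw [e1, e2]
  ring

end Summit.ValiantsHypothesis.ValiantsHypothesis.Theorems.BarrierLever.ChowSubcube
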